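import Literature.Geometry.Riemannian.HeatKernelMeasures
import Literature.Geometry.Riemannian.PerelmanEntropyMonotonicityProofs
import Literature.Geometry.Riemannian.ConjugateHeatPositivity
import Literature.Geometry.Riemannian.NashEntropy
import HarnessLib

/-!
# Duality of heat and conjugate heat solutions along a Ricci flow, and the averaged heat kernel
# measures (Bamler 2020a, §2.3)

R. Bamler, *Entropy and heat kernel bounds on a Ricci flow background*, arXiv:2008.07093 (2020a),
§2.3: for a (super) Ricci flow on a compact manifold the heat kernel `K(x,t;y,s)`, `s < t`, solves
the heat equation in `(x, t)` and the conjugate heat equation `□* = −∂ₛ − Δ + R` in `(y, s)`, the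
conjugate heat kernel measures are `dν_{x,t;s} := K(x,t;·,s) dg_s`, and "if `u ∈ C^∞(M × [s,t])`
solves the heat equation and `v` the conjugate heat equation, then `∫ u v dg_{t'}` is constant in
`t'`" (duality). The tree has the measures `ν_{x,t;s}` (`heatKernelMeasure`,
`HeatKernelMeasures.lean`, built from the solution operator by Riesz–Markov–Kakutani, WITHOUT a
density), smooth conjugate heat flows from smooth final data
(`IsRicciFlow.exists_isConjugateHeatSolutionOn_Icc`, `PerelmanEntropyMonotonicityProofs.lean`)
and their positivity (`ConjugateHeatPositivity.lean`). This file PROVES the duality and its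
consequences for the averaged kernel measures, for a smooth family `h` of Riemannian metrics on a
closed manifold `M` (modelled on `ℝᵐ`) which is a Ricci flow on `[s, t]`, `s < t` (the existence of
the density of `ν_{x,t;s}` itself is derived in `HeatKernelAbsolutelyContinuous.lean`):

* `IsRicciFlow.integral_mul_eq_of_heat_conjugateHeat` — **duality**:
  `∫ w(t)v(t) dV_{h(t)} = ∫ w(s)v(s) dV_{h(s)}` for a heat solution `w` and a conjugate heat
  solution `v` on `M × [s, t]` (`d/dr ∫ wv dV = ∫ ((Δw)v − wΔv) dV = 0`, Green's identity);
* `IsConjugateHeatSolutionOn.comp_sub_const`, `IsRicciFlow.exists_isConjugateHeatSolutionOn_Icc'` —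
  backward solvability of `□*v = 0` on `[s, t]` from smooth final data, `v ≥ 0` for data `≥ 0`;
* `IsRicciFlow.integral_heatValue_mul_eq`, `…integral_heatValueC_mul_eq` — the **pairing identity**
  `∫ (∫ φ dν_{x,t;s}) v(t,x) dV_{h(t)}(x) = ∫ φ v(s) dV_{h(s)}` for smooth, then continuous `φ`;
* `IsRicciFlow.bind_heatKernelMeasure_withDensity_eq` — **the averaged kernel measures have
  density `v(s)`**: `∫ ν_{x,t;s} ψ(x) dV_{h(t)}(x) = v(s) dV_{h(s)}` as measures, `v` the conjugate
  flow of the smooth `ψ ≥ 0` (equality of finite Borel measures tested on bounded continuous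
  functions);
* `IsRicciFlow.heatKernelMeasure_apply_eq_zero_ae` — a `V_{h(s)}`-null Borel set is
  `ν_{x,t;s}`-null for `V_{h(t)}`-a.e. `x` (`ψ = 1`).

What is NOT here: absolute continuity of `ν_{x,t;s}` for EVERY `x` and the density `K(x,t;·,s)`
(`HeatKernelAbsolutelyContinuous.lean`, which adds the strong Feller property), and the smoothness
of `K`. Everything is proved; no definitions, no named facts.

## References

* R. H. Bamler, *Entropy and heat kernel bounds on a Ricci flow background*, arXiv:2008.07093
  (2020), §2.3 (heat operator, conjugate heat operator, `K(x,t;y,s)`, `ν_{x,t;s}`, duality).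
  [Bamler2020Entropy]
* R. H. Bamler, *Compactness theory of the space of super Ricci flows*, Invent. Math. 233 (2023),
  1121–1277, §3.7 (`∫_M K(x,t;·,s) dg_s = 1`). [Bamler2023]
* P. Topping, *Lectures on the Ricci flow*, LMS Lecture Note Series 325, CUP 2006, §6.3, (6.3.2);
  Cor. 3.1.2. [Topping2006]
* A. Friedman, *Partial differential equations of parabolic type*, Prentice-Hall 1964, Ch. 3,
  Thm. 7. [Friedman1964]
-/

noncomputable section

open Bundle Set Function Filter Manifold MeasureTheory Measure TopologicalSpace
open scoped Manifold ContDiff Topology ENNReal NNReal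

namespace Literature.Geometry.Riemannian

open Lorentzian Lorentzian.PseudoRiemannianMetric

section Duality

variable {m : ℕ} {H : Type*} [TopologicalSpace H]
  {I : ModelWithCorners ℝ (EuclideanSpace ℝ (Fin m)) H} [I.Boundaryless]
  {M : Type*} [TopologicalSpace M] [ChartedSpace H M] [IsManifold I ∞ M]
  [T2Space M] [CompactSpace M] [SecondCountableTopology M] [MeasurableSpace M] [BorelSpace M]
  {h : ℝ → PseudoRiemannianMetric I ∞ (EuclideanSpace ℝ (Fin m)) (TangentSpace I : M → Type _)}
  {cov : ℝ → CovariantDerivative I (EuclideanSpace ℝ (Fin m)) (TangentSpace I : M → Type _)}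

omit [SecondCountableTopology M] in
/-- **Duality of the heat and the conjugate heat equation along a Ricci flow** (Bamler 2020a,
§2.3: "if `u` solves the heat equation and `v` the conjugate heat equation, then `∫ u v dg_t` is
constant in `t`"; Topping 2006, (6.3.2) `d/dt ∫ v dV = −∫ □*v dV` applied to the product): for a
Ricci flow of Riemannian metrics `(h, cov)` on `[s, t]`, `s < t`, on a closed manifold modelled on
`ℝᵐ`, a smooth heat solution `w` (`∂ᵣw = Δw`, `IsHeatSolutionOn`) and a smooth conjugate heat
solution `v` (`∂ᵣv = −Δv + Rv`, `IsConjugateHeatSolutionOn`) on `M × [s, t]`,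

  `∫ w(t) v(t) dV_{h(t)} = ∫ w(s) v(s) dV_{h(s)}`

(`d/dr ∫ wv dV = ∫ (∂ᵣ(wv) − R wv) dV = ∫ ((Δw)v − wΔv) dV = 0` by Green's identity).
[cite: Bamler2020Entropy, §2.3] [cite: Topping2006, §6.3, (6.3.2)] -/
theorem IsRicciFlow.integral_mul_eq_of_heat_conjugateHeat {s t : ℝ}
    (hflow : IsRicciFlow h cov (Icc s t)) (hst : s < t) (hR : ∀ r ∈ Icc s t, (h r).IsRiemannian)
    {w v : ℝ → M → ℝ} (hw : IsHeatSolutionOn h w s t)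
    (hv : IsConjugateHeatSolutionOn h cov (Icc s t) v) :
    ∫ x, w t x * v t x ∂(h t).riemVolume = ∫ x, w s x * v s x ∂(h s).riemVolume := by
  have h1le : (1 : ℕ∞ω) ≤ (∞ : ℕ∞ω) := WithTop.coe_le_coe.mpr le_top
  have h2le : (2 : ℕ∞ω) ≤ (∞ : ℕ∞ω) := WithTop.coe_le_coe.mpr le_top
  have hS : Convex ℝ (Icc s t) := convex_Icc s t
  have hU : UniqueDiffOn ℝ (Icc s t) := uniqueDiffOn_Icc hst
  -- the product is smooth on `M × [s, t]`
  have hwv : ContMDiffOn (I.prod 𝓘(ℝ, ℝ)) 𝓘(ℝ, ℝ) ∞ (fun p : M × ℝ ↦ w p.2 p.1 * v p.2 p.1)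
      (univ ×ˢ Icc s t) := hw.1.mul hv.1
  -- its time derivative
  have hderiv : ∀ r ∈ Icc s t, ∀ x, derivWithin (fun r' ↦ w r' x * v r' x) (Icc s t) r =
      (h r).laplaceBeltrami (w r) x * v r x +
        w r x * (-(h r).laplaceBeltrami (v r) x + (h r).scalarCurvatureWith (cov r) x * v r x) := by
    intro r hr x
    have hdw := hw.2 r hr x
    have hdv : HasDerivWithinAt (fun r' ↦ v r' x)
        (-(h r).laplaceBeltrami (v r) x + (h r).scalarCurvatureWith (cov r) x * v r x) (Icc s t) r := by
      have h0 := hasDerivWithinAt_time_of_contMDiffOn (by simp) hv.1 x hr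
      rwa [hv.2 r hr x] at h0
    exact (hdw.mul hdv).derivWithin (hU r hr)
  -- `d/dr ∫ w v dV = 0`
  have hD : ∀ r ∈ Icc s t, HasDerivWithinAt (fun r' ↦ ∫ x, w r' x * v r' x ∂(h r').riemVolume)
      0 (Icc s t) r := by
    intro r hr
    have hder := hflow.hasDerivWithinAt_integral_of_contMDiffOn hS hR
      (v := fun r x ↦ w r x * v r x) hwv hr
    refine hder.congr_deriv ?_
    have hwr : ContMDiff I 𝓘(ℝ, ℝ) ∞ (w r) := contMDiff_slice_of_contMDiffOn hw.1 hr
    have hvr : ContMDiff I 𝓘(ℝ, ℝ) ∞ (v r) := contMDiff_slice_of_contMDiffOn hv.1 hr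
    have e1 : (fun x ↦ derivWithin (fun r' ↦ w r' x * v r' x) (Icc s t) r -
        (h r).scalarCurvatureWith (cov r) x * (w r x * v r x)) =
        fun x ↦ v r x * (h r).laplaceBeltrami (w r) x - w r x * (h r).laplaceBeltrami (v r) x := by
      funext x
      rw [hderiv r hr x]
      ring
    rw [e1, integral_sub, integral_mul_laplaceBeltrami_eq_neg_integral_innerDual (hR r hr)
      (hvr.of_le h1le) (hwr.of_le h2le),
      integral_mul_laplaceBeltrami_eq_neg_integral_innerDual (hR r hr) (hwr.of_le h1le)
      (hvr.of_le h2le)]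
    · simp only [PseudoRiemannianMetric.innerDual_comm, sub_self]
    · have hL := hflow.smooth.contMDiffOn_laplaceBeltrami hU hw.1
      have hLc : Continuous fun x ↦ (h r).laplaceBeltrami (w r) x :=
        (contMDiff_slice_of_contMDiffOn (u := fun r' x ↦ (h r').laplaceBeltrami (w r') x) hL hr).continuous
      exact (h r).integrable_of_continuous (hvr.continuous.mul hLc)
    · have hL := hflow.smooth.contMDiffOn_laplaceBeltrami hU hv.1
      have hLc : Continuous fun x ↦ (h r).laplaceBeltrami (v r) x :=
        (contMDiff_slice_of_contMDiffOn (u := fun r' x ↦ (h r').laplaceBeltrami (v r') x) hL hr).continuous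
      exact (h r).integrable_of_continuous (hwr.continuous.mul hLc)
  have hdiff : DifferentiableOn ℝ (fun r' ↦ ∫ x, w r' x * v r' x ∂(h r').riemVolume) (Icc s t) :=
    fun r hr ↦ (hD r hr).differentiableWithinAt
  exact hS.is_const_of_fderivWithin_eq_zero hdiff
    (fun r hr ↦ by rw [(hD r hr).hasFDerivWithinAt.fderivWithin (hU r hr)]; simp)
    ⟨le_rfl, hst.le⟩ ⟨hst.le, le_rfl⟩ |>.symm

omit [I.Boundaryless] [T2Space M] [CompactSpace M] [SecondCountableTopology M] [MeasurableSpace M]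
  [BorelSpace M] in
/-- Time translation of conjugate heat solutions: if `u` solves `□*u = 0` for the translated flow
`r ↦ (h (r + c), cov (r + c))` on `[a, b]`, then `r ↦ u (r − c)` solves it for `(h, cov)` on
`[a + c, b + c]`. [folklore] -/
theorem IsConjugateHeatSolutionOn.comp_sub_const {a b c : ℝ} (hab : a < b) {u : ℝ → M → ℝ}
    (hu : IsConjugateHeatSolutionOn (fun r ↦ h (r + c)) (fun r ↦ cov (r + c)) (Icc a b) u) :
    IsConjugateHeatSolutionOn h cov (Icc (a + c) (b + c)) (fun r ↦ u (r - c)) := by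
  refine ⟨?_, fun r hr x ↦ ?_⟩
  · have hφ : ContMDiff (I.prod 𝓘(ℝ, ℝ)) (I.prod 𝓘(ℝ, ℝ)) ∞ (fun p : M × ℝ ↦ (p.1, p.2 - c)) :=
      contMDiff_fst.prodMk (contMDiff_snd.sub contMDiff_const)
    refine hu.1.comp hφ.contMDiffOn ?_
    rintro ⟨x, r⟩ ⟨-, hr⟩
    exact ⟨mem_univ _, by linarith [hr.1], by linarith [hr.2]⟩
  · have hr' : r - c ∈ Icc a b := ⟨by linarith [hr.1], by linarith [hr.2]⟩
    have hU : UniqueDiffOn ℝ (Icc a b) := uniqueDiffOn_Icc hab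
    have hU' : UniqueDiffOn ℝ (Icc (a + c) (b + c)) := uniqueDiffOn_Icc (by linarith)
    have h1 : HasDerivWithinAt (fun r'' ↦ u r'' x) (derivWithin (fun r'' ↦ u r'' x) (Icc a b) (r - c))
        (Icc a b) (r - c) := hasDerivWithinAt_time_of_contMDiffOn (by simp) hu.1 x hr'
    have h2 : HasDerivWithinAt (fun r' : ℝ ↦ r' - c) 1 (Icc (a + c) (b + c)) r :=
      (hasDerivWithinAt_id r _).sub_const c
    have hmaps : MapsTo (fun r' : ℝ ↦ r' - c) (Icc (a + c) (b + c)) (Icc a b) :=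
      fun r' hr' ↦ ⟨by linarith [hr'.1], by linarith [hr'.2]⟩
    have h3 := h1.comp r h2 hmaps
    rw [mul_one] at h3
    rw [show (fun r' ↦ u (r' - c) x) = (fun r'' ↦ u r'' x) ∘ (fun r' : ℝ ↦ r' - c) from rfl,
      h3.derivWithin (hU' r hr), hu.2 (r - c) hr' x]
    simp only [sub_add_cancel]

/-- **Backward solvability of `□*v = 0` on `[s, t]` from smooth final data at time `t`** (the
tree's `IsRicciFlow.exists_isConjugateHeatSolutionOn_Icc` — linear parabolic theory, Friedman 1964
Ch. 3 Thm. 7 — translated from `[0, t − s]`), with `v ≥ 0` for data `≥ 0`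
(`IsRicciFlow.nonneg_of_isConjugateHeatSolutionOn`). [cite: Friedman1964, Ch. 3, Thm. 7]
[cite: Topping2006, Cor. 3.1.2 (p. 35)] -/
theorem IsRicciFlow.exists_isConjugateHeatSolutionOn_Icc' {s t : ℝ}
    (hflow : IsRicciFlow h cov (Icc s t)) (hst : s < t) (hR : ∀ r ∈ Icc s t, (h r).IsRiemannian)
    {ψ : M → ℝ} (hψ : ContMDiff I 𝓘(ℝ, ℝ) ∞ ψ) :
    ∃ v : ℝ → M → ℝ, v t = ψ ∧ IsConjugateHeatSolutionOn h cov (Icc s t) v ∧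
      ((∀ x, 0 ≤ ψ x) → ∀ r ∈ Icc s t, ∀ x, 0 ≤ v r x) := by
  have hflow' : IsRicciFlow (fun r ↦ h (r + s)) (fun r ↦ cov (r + s)) (Icc 0 (t - s)) := by
    refine (hflow.comp_add_const s).mono fun r hr ↦ ?_
    exact ⟨by linarith [hr.1], by linarith [hr.2]⟩
  have hR' : ∀ r ∈ Icc (0 : ℝ) (t - s), (h (r + s)).IsRiemannian := fun r hr ↦
    hR (r + s) ⟨by linarith [hr.1], by linarith [hr.2]⟩
  obtain ⟨u, huT, hu⟩ := hflow'.exists_isConjugateHeatSolutionOn_Icc (sub_pos.2 hst) hR' ψ hψ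
  have key := hu.comp_sub_const (h := h) (cov := cov) (sub_pos.2 hst)
  simp only [zero_add, sub_add_cancel] at key
  refine ⟨fun r ↦ u (r - s), by simp [huT], key, fun hψ0 r hr x ↦ ?_⟩
  have hnn := hflow'.nonneg_of_isConjugateHeatSolutionOn hR' hu (by rw [huT]; exact hψ0)
  exact hnn (r - s) ⟨by linarith [hr.1], by linarith [hr.2]⟩ x

end Duality


section Pairing

variable {m : ℕ} {H : Type*} [TopologicalSpace H]
  {I : ModelWithCorners ℝ (EuclideanSpace ℝ (Fin m)) H} [I.Boundaryless]
  {M : Type*} [TopologicalSpace M] [ChartedSpace H M] [IsManifold I ∞ M]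
  [T2Space M] [CompactSpace M] [SecondCountableTopology M] [MeasurableSpace M] [BorelSpace M]
  {h : ℝ → PseudoRiemannianMetric I ∞ (EuclideanSpace ℝ (Fin m)) (TangentSpace I : M → Type _)}
  {cov : ℝ → CovariantDerivative I (EuclideanSpace ℝ (Fin m)) (TangentSpace I : M → Type _)}
  (hh : IsContMDiffFamilyOn ∞ h univ) (hR : ∀ r, (h r).IsRiemannian)

include hh hR in
/-- **The pairing identity for smooth data**: for a Ricci flow on `[s, t]`, `s < t`, a smooth
datum `φ` and a conjugate heat solution `v` on `M × [s, t]`,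
`∫ (P_{s→t}φ)(x) v(t, x) dV_{h(t)}(x) = ∫ φ(y) v(s, y) dV_{h(s)}(y)` (duality
`IsRicciFlow.integral_mul_eq_of_heat_conjugateHeat` for the smooth solution realising `P_{s→·}φ`).
[cite: Bamler2020Entropy, §2.3] -/
theorem IsRicciFlow.integral_heatValue_mul_eq {s t : ℝ} (hflow : IsRicciFlow h cov (Icc s t))
    (hst : s < t) {φ : M → ℝ} (hφ : ContMDiff I 𝓘(ℝ, ℝ) ∞ φ) {v : ℝ → M → ℝ}
    (hv : IsConjugateHeatSolutionOn h cov (Icc s t) v) :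
    ∫ x, heatValue h s t x φ * v t x ∂(h t).riemVolume = ∫ y, φ y * v s y ∂(h s).riemVolume := by
  obtain ⟨w, hw, hw0, hwv⟩ := exists_isHeatSolutionOn_heatValue hh hR hst hφ
  have key := hflow.integral_mul_eq_of_heat_conjugateHeat hst (fun r _ ↦ hR r) hw hv
  rw [hw0] at key
  rw [← key]
  refine integral_congr_ae (Eventually.of_forall fun x ↦ ?_)
  simp only [hwv t ⟨hst.le, le_rfl⟩ x]

include hh hR in
/-- **The pairing identity for continuous data**: `∫ (∫ φ dν_{x,t;s}) v(t, x) dV_{h(t)}(x) =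
∫ φ(y) v(s, y) dV_{h(s)}(y)` for `φ` continuous and `v` a conjugate heat solution on `M × [s, t]`
(uniform approximation of `φ` by smooth data; the sup-norm contraction of `P_{s→t}`).
[cite: Bamler2020Entropy, §2.3] -/
theorem IsRicciFlow.integral_heatValueC_mul_eq {s t : ℝ} (hflow : IsRicciFlow h cov (Icc s t))
    (hst : s < t) {φ : M → ℝ} (hφ : Continuous φ) {v : ℝ → M → ℝ}
    (hv : IsConjugateHeatSolutionOn h cov (Icc s t) v) :
    ∫ x, heatValueC h s t x φ * v t x ∂(h t).riemVolume = ∫ y, φ y * v s y ∂(h s).riemVolume := by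
  have hvt : Continuous (v t) := (contMDiff_slice_of_contMDiffOn hv.1 ⟨hst.le, le_rfl⟩).continuous
  have hvs : Continuous (v s) := (contMDiff_slice_of_contMDiffOn hv.1 ⟨le_rfl, hst.le⟩).continuous
  set ε : ℕ → ℝ := fun n ↦ 1 / ((n : ℝ) + 1) with hε
  have hεt : Tendsto ε atTop (𝓝 0) := tendsto_one_div_add_atTop_nhds_zero_nat (𝕜 := ℝ)
  -- the identity for the smooth approximants
  have hn : ∀ n, ∫ x, heatValue h s t x (smoothApprox I φ n) * v t x ∂(h t).riemVolume =
      ∫ y, smoothApprox I φ n y * v s y ∂(h s).riemVolume := fun n ↦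
    hflow.integral_heatValue_mul_eq hh hR hst (contMDiff_smoothApprox hφ n) hv
  -- both sides converge
  have hPc : Continuous fun x ↦ heatValueC h s t x φ := continuous_heatValueC hh hR s t hφ
  have hPn : ∀ n, Continuous fun x ↦ heatValue h s t x (smoothApprox I φ n) := fun n ↦
    (contMDiff_heatValue hh hR (contMDiff_smoothApprox hφ n)).continuous
  have hL : Tendsto (fun n ↦ ∫ x, heatValue h s t x (smoothApprox I φ n) * v t x ∂(h t).riemVolume)
      atTop (𝓝 (∫ x, heatValueC h s t x φ * v t x ∂(h t).riemVolume)) := by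
    rw [tendsto_iff_norm_sub_tendsto_zero]
    have hbound : ∀ n, ‖(∫ x, heatValue h s t x (smoothApprox I φ n) * v t x ∂(h t).riemVolume) -
        ∫ x, heatValueC h s t x φ * v t x ∂(h t).riemVolume‖ ≤
        ε n * ∫ x, |v t x| ∂(h t).riemVolume := by
      intro n
      have hA : Integrable (fun x ↦ heatValue h s t x (smoothApprox I φ n) * v t x) (h t).riemVolume :=
        (h t).integrable_of_continuous ((hPn n).mul hvt)
      have hB : Integrable (fun x ↦ heatValueC h s t x φ * v t x) (h t).riemVolume :=
        (h t).integrable_of_continuous (hPc.mul hvt)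
      have hC : Integrable (fun x ↦ ε n * |v t x|) (h t).riemVolume :=
        (h t).integrable_of_continuous (continuous_const.mul hvt.abs)
      rw [← integral_sub hA hB, ← integral_const_mul]
      refine norm_integral_le_of_norm_le hC (Eventually.of_forall fun x ↦ ?_)
      rw [Real.norm_eq_abs, ← sub_mul, abs_mul]
      refine mul_le_mul_of_nonneg_right ?_ (abs_nonneg _)
      exact abs_heatValue_sub_heatValueC_le hh hR x hφ (contMDiff_smoothApprox hφ n)
        fun y ↦ (abs_smoothApprox_sub_lt (I := I) hφ n y).le
    refine squeeze_zero (fun n ↦ norm_nonneg _) hbound ?_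
    simpa using hεt.mul_const (∫ x, |v t x| ∂(h t).riemVolume)
  have hRt : Tendsto (fun n ↦ ∫ y, smoothApprox I φ n y * v s y ∂(h s).riemVolume)
      atTop (𝓝 (∫ y, φ y * v s y ∂(h s).riemVolume)) := by
    rw [tendsto_iff_norm_sub_tendsto_zero]
    have hbound : ∀ n, ‖(∫ y, smoothApprox I φ n y * v s y ∂(h s).riemVolume) -
        ∫ y, φ y * v s y ∂(h s).riemVolume‖ ≤ ε n * ∫ y, |v s y| ∂(h s).riemVolume := by
      intro n
      have hA : Integrable (fun y ↦ smoothApprox I φ n y * v s y) (h s).riemVolume :=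
        (h s).integrable_of_continuous ((contMDiff_smoothApprox hφ n).continuous.mul hvs)
      have hB : Integrable (fun y ↦ φ y * v s y) (h s).riemVolume :=
        (h s).integrable_of_continuous (hφ.mul hvs)
      have hC : Integrable (fun y ↦ ε n * |v s y|) (h s).riemVolume :=
        (h s).integrable_of_continuous (continuous_const.mul hvs.abs)
      rw [← integral_sub hA hB, ← integral_const_mul]
      refine norm_integral_le_of_norm_le hC (Eventually.of_forall fun y ↦ ?_)
      rw [Real.norm_eq_abs, ← sub_mul, abs_mul]
      exact mul_le_mul_of_nonneg_right (abs_smoothApprox_sub_lt (I := I) hφ n y).le (abs_nonneg _)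
    refine squeeze_zero (fun n ↦ norm_nonneg _) hbound ?_
    simpa using hεt.mul_const (∫ y, |v s y| ∂(h s).riemVolume)
  exact tendsto_nhds_unique (hL.congr hn) hRt

include hh hR in
/-- **The averaged heat kernel measures have the conjugate heat solution as density** (Bamler
2020a, §2.3: `dν_{x,t;s} = K(x,t;·,s) dg_s` with `K(x,t;·,·)` solving the conjugate heat equation,
here in integrated form, the density `K` not being available): for a Ricci flow on `[s, t]`,
`s < t`, a smooth `ψ ≥ 0` and the conjugate heat solution `v ≥ 0` on `M × [s, t]` with
`v(t) = ψ`,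

  `∫ ν_{x,t;s}(·) ψ(x) dV_{h(t)}(x) = v(s, ·) dV_{h(s)}`

as Borel measures on `M` (`Measure.bind` of `ψ dV_{h(t)}` along `x ↦ ν_{x,t;s}` equals
`v(s) dV_{h(s)}`): both are finite measures with the same integrals of bounded continuous functions
(`IsRicciFlow.integral_heatValueC_mul_eq`). [cite: Bamler2020Entropy, §2.3] -/
theorem IsRicciFlow.bind_heatKernelMeasure_withDensity_eq {s t : ℝ}
    (hflow : IsRicciFlow h cov (Icc s t)) (hst : s < t) {ψ : M → ℝ}
    (hψ : ContMDiff I 𝓘(ℝ, ℝ) ∞ ψ) (hψ0 : ∀ x, 0 ≤ ψ x) {v : ℝ → M → ℝ}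
    (hv : IsConjugateHeatSolutionOn h cov (Icc s t) v) (hvt : v t = ψ)
    (hv0 : ∀ r ∈ Icc s t, ∀ x, 0 ≤ v r x) :
    ((h t).riemVolume.withDensity fun x ↦ ENNReal.ofReal (ψ x)).bind
        (fun x ↦ heatKernelMeasure hh hR t x s) =
      (h s).riemVolume.withDensity fun y ↦ ENNReal.ofReal (v s y) := by
  haveI : MetrizableSpace M := Manifold.metrizableSpace I M
  haveI : IsFiniteMeasure (h t).riemVolume := ⟨(h t).riemVolume_univ_lt_top⟩
  haveI : IsFiniteMeasure (h s).riemVolume := ⟨(h s).riemVolume_univ_lt_top⟩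
  have hψc : Continuous ψ := hψ.continuous
  have hvs : Continuous (v s) := (contMDiff_slice_of_contMDiffOn hv.1 ⟨le_rfl, hst.le⟩).continuous
  have hψm : Measurable fun x ↦ ENNReal.ofReal (ψ x) := ENNReal.measurable_ofReal.comp hψc.measurable
  have hvm : Measurable fun y ↦ ENNReal.ofReal (v s y) := ENNReal.measurable_ofReal.comp hvs.measurable
  have hmeas := measurable_heatKernelMeasure hh hR t s
  -- finiteness
  haveI : IsFiniteMeasure ((h t).riemVolume.withDensity fun x ↦ ENNReal.ofReal (ψ x)) := by
    refine ⟨?_⟩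
    rw [withDensity_apply _ MeasurableSet.univ, Measure.restrict_univ]
    obtain ⟨C, hC⟩ := isCompact_univ.exists_bound_of_continuousOn (f := ψ) hψc.continuousOn
    calc ∫⁻ x, ENNReal.ofReal (ψ x) ∂(h t).riemVolume ≤ ∫⁻ _, ENNReal.ofReal C ∂(h t).riemVolume :=
          lintegral_mono fun x ↦ ENNReal.ofReal_le_ofReal
            ((le_abs_self _).trans (by simpa using hC x (mem_univ x)))
      _ < ⊤ := by
          rw [lintegral_const]
          exact ENNReal.mul_lt_top ENNReal.ofReal_lt_top (measure_lt_top _ _)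
  haveI : IsFiniteMeasure (((h t).riemVolume.withDensity fun x ↦ ENNReal.ofReal (ψ x)).bind
      fun x ↦ heatKernelMeasure hh hR t x s) := by
    refine ⟨?_⟩
    rw [Measure.bind_apply MeasurableSet.univ hmeas.aemeasurable]
    simp only [measure_univ, lintegral_one]
    exact measure_lt_top _ _
  haveI : IsFiniteMeasure ((h s).riemVolume.withDensity fun y ↦ ENNReal.ofReal (v s y)) := by
    refine ⟨?_⟩
    rw [withDensity_apply _ MeasurableSet.univ, Measure.restrict_univ]
    obtain ⟨C, hC⟩ := isCompact_univ.exists_bound_of_continuousOn (f := v s) hvs.continuousOn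
    calc ∫⁻ y, ENNReal.ofReal (v s y) ∂(h s).riemVolume ≤ ∫⁻ _, ENNReal.ofReal C ∂(h s).riemVolume :=
          lintegral_mono fun y ↦ ENNReal.ofReal_le_ofReal
            ((le_abs_self _).trans (by simpa using hC y (mem_univ y)))
      _ < ⊤ := by
          rw [lintegral_const]
          exact ENNReal.mul_lt_top ENNReal.ofReal_lt_top (measure_lt_top _ _)
  refine ext_of_forall_lintegral_eq_of_IsFiniteMeasure fun f ↦ ?_
  have hfc : Continuous fun z ↦ ((f z : ℝ≥0) : ℝ) := NNReal.continuous_coe.comp f.continuous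
  have hfm : Measurable fun z ↦ ((f z : ℝ≥0) : ℝ≥0∞) := f.continuous.measurable.coe_nnreal_ennreal
  -- left-hand side
  have hIm : Measurable fun x ↦ ∫⁻ z, ((f z : ℝ≥0) : ℝ≥0∞) ∂(heatKernelMeasure hh hR t x s) :=
    (Measure.measurable_lintegral hfm).comp hmeas
  rw [Measure.lintegral_bind hmeas.aemeasurable hfm.aemeasurable,
    lintegral_withDensity_eq_lintegral_mul _ hψm hIm,
    lintegral_withDensity_eq_lintegral_mul _ hvm hfm]
  -- `∫⁻ f dν_{x,t;s} = ofReal (heatValueC f (x))`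
  have hinner : ∀ x, ∫⁻ z, ((f z : ℝ≥0) : ℝ≥0∞) ∂(heatKernelMeasure hh hR t x s) =
      ENNReal.ofReal (heatValueC h s t x fun z ↦ ((f z : ℝ≥0) : ℝ)) := fun x ↦ by
    rw [lintegral_coe_eq_integral _ (f.integrable_of_nnreal _),
      integral_heatKernelMeasure hh hR hst x hfc]
  have hP0 : ∀ x, 0 ≤ heatValueC h s t x fun z ↦ ((f z : ℝ≥0) : ℝ) := fun x ↦ by
    have h0 := heatValueC_mono hh hR (s := s) (t := t) x continuous_const hfc
      fun z ↦ NNReal.coe_nonneg (f z)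
    rwa [heatValueC_const hh hR] at h0
  have hPc : Continuous fun x ↦ heatValueC h s t x fun z ↦ ((f z : ℝ≥0) : ℝ) :=
    continuous_heatValueC hh hR s t hfc
  have e1 : (fun x ↦ ((fun x ↦ ENNReal.ofReal (ψ x)) *
      fun x ↦ ∫⁻ z, ((f z : ℝ≥0) : ℝ≥0∞) ∂(heatKernelMeasure hh hR t x s)) x) =
      fun x ↦ ENNReal.ofReal ((heatValueC h s t x fun z ↦ ((f z : ℝ≥0) : ℝ)) * ψ x) := by
    funext x
    simp only [Pi.mul_apply, hinner x]
    rw [← ENNReal.ofReal_mul (hψ0 x), mul_comm]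
  have e2 : (fun y ↦ ((fun y ↦ ENNReal.ofReal (v s y)) * fun z ↦ ((f z : ℝ≥0) : ℝ≥0∞)) y) =
      fun y ↦ ENNReal.ofReal (((f y : ℝ≥0) : ℝ) * v s y) := by
    funext y
    simp only [Pi.mul_apply]
    rw [ENNReal.ofReal_mul (NNReal.coe_nonneg _), ENNReal.ofReal_coe_nnreal, mul_comm]
  have hi1 : Integrable (fun x ↦ (heatValueC h s t x fun z ↦ ((f z : ℝ≥0) : ℝ)) * ψ x)
      (h t).riemVolume := (h t).integrable_of_continuous (hPc.mul hψc)
  have hi2 : Integrable (fun y ↦ ((f y : ℝ≥0) : ℝ) * v s y) (h s).riemVolume :=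
    (h s).integrable_of_continuous (hfc.mul hvs)
  rw [e1, e2, ← ofReal_integral_eq_lintegral_ofReal hi1
      (Eventually.of_forall fun x ↦ mul_nonneg (hP0 x) (hψ0 x)),
    ← ofReal_integral_eq_lintegral_ofReal hi2
      (Eventually.of_forall fun y ↦ mul_nonneg (NNReal.coe_nonneg _) (hv0 s ⟨le_rfl, hst.le⟩ y)),
    show (fun x ↦ (heatValueC h s t x fun z ↦ ((f z : ℝ≥0) : ℝ)) * ψ x) =
      fun x ↦ (heatValueC h s t x fun z ↦ ((f z : ℝ≥0) : ℝ)) * v t x from by rw [hvt],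
    hflow.integral_heatValueC_mul_eq hh hR hst hfc hv]

include hh hR in
/-- **Null sets of `dV_{h(s)}` are `ν_{x,t;s}`-null for `dV_{h(t)}`-a.e. `x`**: for a Ricci flow on
`[s, t]`, `s < t`, and a Borel set `S` with `V_{h(s)}(S) = 0`, `ν_{x,t;s}(S) = 0` for
`V_{h(t)}`-almost every `x` (the averaged identity with `ψ = 1`, whose conjugate solution is
`≥ 0`). [cite: Bamler2020Entropy, §2.3] -/
theorem IsRicciFlow.heatKernelMeasure_apply_eq_zero_ae {s t : ℝ}
    (hflow : IsRicciFlow h cov (Icc s t)) (hst : s < t) {S : Set M} (hS : MeasurableSet S)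
    (hS0 : (h s).riemVolume S = 0) :
    ∀ᵐ x ∂(h t).riemVolume, heatKernelMeasure hh hR t x s S = 0 := by
  obtain ⟨v, hvt, hv, hv0⟩ := hflow.exists_isConjugateHeatSolutionOn_Icc' hst (fun r _ ↦ hR r)
    (ψ := fun _ ↦ (1 : ℝ)) contMDiff_const
  have key := hflow.bind_heatKernelMeasure_withDensity_eq hh hR hst contMDiff_const
    (fun _ ↦ zero_le_one) hv hvt (hv0 fun _ ↦ zero_le_one)
  simp only [ENNReal.ofReal_one] at key
  rw [show (fun _ : M ↦ (1 : ℝ≥0∞)) = 1 from rfl, withDensity_one] at key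
  have h1 : ((h t).riemVolume.bind fun x ↦ heatKernelMeasure hh hR t x s) S = 0 := by
    rw [key]
    exact withDensity_absolutelyContinuous _ _ hS0
  have hSm : Measurable fun x ↦ heatKernelMeasure hh hR t x s S :=
    (Measure.measurable_coe hS).comp (measurable_heatKernelMeasure hh hR t s)
  rw [Measure.bind_apply hS (measurable_heatKernelMeasure hh hR t s).aemeasurable,
    lintegral_eq_zero_iff hSm] at h1
  filter_upwards [h1] with x hx
  simpa using hx

end Pairing




end Literature.Geometry.Riemannian

end
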